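import Summits.QuantumFields.YangMills.Theorems.BalabanUVNodesC44IterMhPlaqBridge
import Summits.QuantumFields.YangMills.Theorems.BalabanUVNodesC44IterMhRegularPr
import HarnessLib

/-!
# (ℓa-C) ROAD B, FRAMED EDITION (ρ-frame-min), FILE F7ᵖʳ∕F8ᵖʳ — PROP. 4 AT THE RECORD FROM THE H-COLUMN LETTERS, FRAMED: the six doors of ✓`…C44IterMhProp4Node00` (F7) and
# ✓`…C44IterMhPlaqBridge` (F8) re-keyed at node00-def-Y's `Prop4UniformPrAtRecord` ∕ `Prop4Letter{H,Columns}PrAtRecord` over a frame datum `𝔥`, the (ℓa-C)ᵖʳ slot filled from (14)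

Cell `pub-ymgap` ∕ `ym-nodeO-ideate`, porter lineage `ymgap-nodeO-port-PTB-1` (gen 9); re-press (B) of director-ym g23 №608 (ROAD WORD FINAL), doors `…Prop4Node00Pr`∕`…PlaqBridgePr` batched
in one file (D-0064); filed behind (A3) ✓p829152 and the G-door ✓`…Prop4UniformAtRecordPr`; `--kind proof --supports stmt-QuantumFields-27238 --as helper`; count-neutral; NEW basename,
append-nothing (F7∕F8 stay, USE-HELD for the frame-free letters).  [B11] = [Balaban1985Variational]; [B7] = [Balaban1985Averaging].

RE-KEYING RULE (def-Y PRICE #2 (B)): `QOfRecord U₀ ↦ QprOfRecord U₀ 𝔥`, `Q′♭ ↦ QprimeOfRecord U₀`, `Prop4…AtRecord ↦ Prop4…PrAtRecord … 𝔥`, `C₂ = 1.28·10¹⁶·L·N ↦ 3.2·10¹⁶·L·N`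
(F5ᵖʳ's constant), and the (ℓa-C)ᵖʳ supplier ✓`prop4LetterCPrAtRecord_of_regular` brings its three extra DISPLAYED binders `hc : c𝔥 ≤ 10³`, (hdom), (hnear) (frame window and
frame-near-`1` on the traceless scaled polydisc) into every door; everything else — `hpl`∕`hpl0`∕`hk`, the (14) current window `h14`, unit weights, `CV`, `c4OfRecord` — is chart-free
and VERBATIM; proofs word for word.

WHAT IS PROVED (0 def, 0 sorry, axioms standard; ns `Summit.QuantumFields.YangMills.Theorems.C44IterMh`): ★★★ `prop4UniformPrAtRecord_node00_of_HCol` ∕ ★★★ `…_window` (F7 twins),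
★★ `…_plaqSmall` ∕ `…_pos` ∕ `…_window_plaqSmall` ∕ `…_window_pos` (F8 twins: tree-side `j = 0` plaquette clause ∕ none for `0 < k`).

HONEST FRAMING.  Doors re-keyed, nothing else: (ℓa-H)ᵖʳ `hH` and (ℓd)ᵖʳ `hcol` are HYPOTHESES, (ℓa-C)ᵖʳ is filled only in the small-field approximation and MODULO (hdom)∕(hnear),
proved for NO non-trivial frame (no frame is constructed in the tree yet; (A1) is node00-def-Y's); `hpos`∕`hQ` DISPLAYED binders; (R1)∕(R2) OPEN; K0ᴬ ⟨stmt-QuantumFields-27238⟩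
NOT closed; NODE O 0∕1; COUNT 8∕28 · K 1∕4 UNMOVED; finite `𝕋⁴_{L^K}` at fixed ε — NOT continuum ∕ ℝ⁴ ∕ OS ∕ Clay; **the Yang–Mills mass gap (Clay) is NOT proved by any of this.**
No `sorry`, `instance`, `notation`, `set_option`; standard axioms.
-/

noncomputable section

open scoped Matrix Matrix.Norms.L2Operator InnerProductSpace ComplexConjugate Topology NNReal

namespace Summit.QuantumFields.YangMills.Theorems.C44IterMh

open Literature.MathematicalPhysics.QuantumFieldTheory.Balaban1983to89
open Literature.MathematicalPhysics.QuantumFieldTheory.Balaban1983to89.Node00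
open T4Continuum BlockAveraging
open B9Eq310DeltaPrime (plaqHolU)
open B11Eq103H1Complex (SiteL2K)
open B11Eq115Space (NegSup levWeight levWeight_apply le_levOf)
open Summit.QuantumFields.YangMills.Theorems.Prop4UniformAtRecord (prop4UniformPrAtRecord_of_recordLetters_numeric)

section Record

variable (F : T4Family) (N : ℕ) [NeZero N] (K k : ℕ) (Ω : ℕ → Set (Site (F.P K) 0)) (U₀ : GaugeField (F.P K) 0 (SU N))

/-! ## §1  F7ᵖʳ — the framed Prop. 4 from the H-column letters and a regular background -/

/-- ★★★ **[B11] PROP. 4 AT THE RECORD IN THE NODE-00 REGIME, REDUCED BY NAME TO (ℓa-H) + (ℓd) + `‖J‖`** — see the module docstring for the reading; (ℓa-C) from print's (14) by F6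
✓`prop4LetterCAtRecord_of_regular`, (ℓa-num)∕(ℓb)∕(ℓc) inside the g6 door ✓`prop4UniformAtRecord_of_recordLetters_numeric`, weights `ω = Ω = 1` at the top level.
[cite: Balaban1985Variational, Prop. 4 (97)–(98) pp.292–293, (14) p.280, (44)–(45) p.285, (86)–(89) p.291] -/
theorem prop4UniformPrAtRecord_node00_of_HCol [Fact (0 < (F.L : ℝ))] [Fact (0 < (F.P K).eta k)] [Fact (0 < c0Rec F K k)] [Fact (∀ c, 0 < wBRec F K k c)]
    (𝔥 : FrameDatum (F.P K) N k U₀) (levB : PBond (F.P K) k → ℕ) (a : ℝ)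
    (hpos : ∀ x, x ≠ 0 → 0 < RCLike.re ⟪x, laplaceAOfRecord F N k U₀ (QprOfRecord F N k U₀ 𝔥) (QprimeOfRecord F N k U₀) a x⟫_ℂ)
    (hQ : Function.Surjective (QprOfRecord F N k U₀ 𝔥))
    (Gp : SiteL2K ℂ (F.P K).d (fun _ => (F.P K).sitesPerDir 0) (c0Rec F K k) (WRec N) →ₗ[ℂ]
      SiteL2K ℂ (F.P K).d (fun _ => (F.P K).sitesPerDir 0) (c0Rec F K k) (WRec N))
    {b α θ₃ θE θE' N₁ nJ : ℝ} (hb : 0 ≤ b) (hΩ : ∀ x, x ∈ Ω k) (hα0 : 0 ≤ α) (hα : α * (11000000 * N) ≤ 1)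
    (hreg : ∀ j, j < k → PlaqSmall (α * ((F.L : ℝ) ^ j * (F.P K).eta k) ^ 2) (Averaging.iter (avOfRecord F N K) j U₀))
    (hpl : ∀ p : B9SectCLatticeCarrier.Plaq (F.P K).d (fun _ => (F.P K).sitesPerDir 0),
      ‖(plaqHolU (unitsOfRecord F N U₀) p : Matrix (Fin N) (Fin N) ℂ) - 1‖ ≤ α * (F.P K).eta k ^ 2)
    {c𝔥 : ℝ} (hc : c𝔥 ≤ 1000)
    (hdom : ∀ Y : PBond (F.P K) 0 → Matrix (Fin N) (Fin N) ℂ, (∀ b, (Y b).trace = 0) → (F.L : ℝ) ^ k * ‖Y‖ < 1 / (25000000000 * (F.L : ℝ) * N) →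
      expOver U₀ Y ∈ 𝔥.dom)
    (hnear : ∀ Y : PBond (F.P K) 0 → Matrix (Fin N) (Fin N) ℂ, (∀ b, (Y b).trace = 0) → (F.L : ℝ) ^ k * ‖Y‖ < 1 / (25000000000 * (F.L : ℝ) * N) →
      ∀ y : Site (F.P K) k, ‖𝔥.map (expOver U₀ Y) y - 1‖ ≤ c𝔥 * ((F.L : ℝ) ^ k * ‖Y‖) ∧ ‖𝔥.inv (expOver U₀ Y) y - 1‖ ≤ c𝔥 * ((F.L : ℝ) ^ k * ‖Y‖))
    (hH : Prop4LetterHPrAtRecord F N K k Ω U₀ 𝔥 levB a hpos hQ b)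
    (hcol : letI C₂ : ℝ := 32000000000000000 * (F.L : ℝ) * N
      letI c₄ : ℝ := 1 / (200000000000 * (F.L : ℝ) * N)
      letI r : ℝ := min (c₄ / 4) (min (1 / 2) (1 / (16 * (b * C₂ + 1))))
      Prop4LetterColumnsPrAtRecord F N K k Ω U₀ 𝔥 levB a hpos hQ r Gp (min r ((1 - 4 * b * C₂ * (r + r)) * (1 / 16))) θ₃ θE θE' N₁)
    (hJ : ‖JOfRecordAtBg F N K k Ω U₀‖ ≤ nJ) :
    letI C₂ : ℝ := 32000000000000000 * (F.L : ℝ) * N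
    letI c₄ : ℝ := 1 / (200000000000 * (F.L : ℝ) * N)
    letI r : ℝ := min (c₄ / 4) (min (1 / 2) (1 / (16 * (b * C₂ + 1))))
    letI R' : ℝ := min r ((1 - 4 * b * C₂ * (r + r)) * (1 / 16))
    letI CV : ℝ := 1024 * (((F.P K).d - 1 : ℕ) : ℝ) * ((1 : ℝ) * 1) ^ 3 * N * (α * (1 : ℝ) ^ 2 + 1 / 16)
        + (((F.P K).d - 1 : ℕ) : ℝ) * ((1 : ℝ) * 1) ^ 3 * (136 + 2 * ((1 : ℝ) * 1)) * N
    Prop4UniformPrAtRecord F N K k Ω U₀ 𝔥 levB a hpos hQ r Gp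
      ((N * θ₃ * nJ + (N₁ * C₂ * (1 / (1 - 4 * b * C₂ * (r + r))) ^ 2 + N * θE')
        + N * θE * (N₁ * C₂ * (1 / (1 - 4 * b * C₂ * (r + r))) ^ 2) * R'
        + N * (1 + θE * R') * CV * (1 / (1 - 4 * b * C₂ * (r + r))) ^ 2)) R' := by
  have hLN : (0 : ℝ) < (F.L : ℝ) * N := mul_pos Fact.out (by exact_mod_cast Nat.pos_of_ne_zero (NeZero.ne N))
  have hC₂ : (0 : ℝ) ≤ 32000000000000000 * (F.L : ℝ) * N := by rw [mul_assoc]; positivity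
  have hc₄ : (0 : ℝ) < 1 / (200000000000 * (F.L : ℝ) * N) := by rw [mul_assoc]; positivity
  have hwb : ∀ i, levWeight (F.L : ℝ) ((F.P K).eta k) (bondLevLit F Ω k) 1 i = 1 := levWeight_bondLevLit_eq_one F k Ω hΩ
  have hwp : ∀ p, levWeight (F.L : ℝ) ((F.P K).eta k) (pairLevLit F Ω k) 2 p = 1 := levWeight_pairLevLit_eq_one F K k Ω hΩ
  exact prop4UniformPrAtRecord_of_recordLetters_numeric F N K k Ω U₀ 𝔥 levB a hpos hQ Gp hb hC₂ hc₄ hH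
    (prop4LetterCPrAtRecord_of_regular F N k Ω U₀ 𝔥 levB hΩ hα0 hα hreg hc hdom hnear) hα0 hpl le_rfl le_rfl (wSup_le_one_of_eq_one _ hwb)
    (wInvSup_le_one_of_eq_one _ hwb) (wInvSup_le_one_of_eq_one _ hwp) hcol hJ

/-- ★★★ **THE SAME AT PRINT'S (14) CURRENT WINDOW** — `‖J‖ ≤ C₁B₃ε₁` supplied by ✓`Node00.norm_JOfRecordAtBg_le` from the bondwise current clause `InU2cur … (C₁B₃ε₁)` of
`U₀ ∈ 𝔘_k({Ω_j}, C₁B₃ε₁)`; the antecedent is now (ℓa-H) + (ℓd) + DOMAIN CLAUSES OF PRINT ((14): plaquettes at all scales `j < k`, plaquettes of `U₀` on lit's carrier, the current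
window) and nothing else. [cite: Balaban1985Variational, Prop. 4 (97)–(98) pp.292–293, (14) p.280, (28) p.282] -/
theorem prop4UniformPrAtRecord_node00_of_HCol_window [Fact (0 < (F.L : ℝ))] [Fact (0 < (F.P K).eta k)] [Fact (0 < c0Rec F K k)] [Fact (∀ c, 0 < wBRec F K k c)]
    (𝔥 : FrameDatum (F.P K) N k U₀) (levB : PBond (F.P K) k → ℕ) (a : ℝ)
    (hpos : ∀ x, x ≠ 0 → 0 < RCLike.re ⟪x, laplaceAOfRecord F N k U₀ (QprOfRecord F N k U₀ 𝔥) (QprimeOfRecord F N k U₀) a x⟫_ℂ)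
    (hQ : Function.Surjective (QprOfRecord F N k U₀ 𝔥))
    (Gp : SiteL2K ℂ (F.P K).d (fun _ => (F.P K).sitesPerDir 0) (c0Rec F K k) (WRec N) →ₗ[ℂ]
      SiteL2K ℂ (F.P K).d (fun _ => (F.P K).sitesPerDir 0) (c0Rec F K k) (WRec N))
    {b α θ₃ θE θE' N₁ C₁ B₃ ε₁ : ℝ} (hb : 0 ≤ b) (hΩ : ∀ x, x ∈ Ω k) (hα0 : 0 ≤ α) (hα : α * (11000000 * N) ≤ 1)
    (hreg : ∀ j, j < k → PlaqSmall (α * ((F.L : ℝ) ^ j * (F.P K).eta k) ^ 2) (Averaging.iter (avOfRecord F N K) j U₀))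
    (hpl : ∀ p : B9SectCLatticeCarrier.Plaq (F.P K).d (fun _ => (F.P K).sitesPerDir 0),
      ‖(plaqHolU (unitsOfRecord F N U₀) p : Matrix (Fin N) (Fin N) ℂ) - 1‖ ≤ α * (F.P K).eta k ^ 2)
    (hK : 0 ≤ C₁ * B₃ * ε₁) (h14 : B11Prop6Concrete.InU2cur (F.L : ℝ) ((F.P K).eta k) (bondLevLit F Ω k) (C₁ * B₃ * ε₁) (unitsOfRecord F N U₀))
    {c𝔥 : ℝ} (hc : c𝔥 ≤ 1000)
    (hdom : ∀ Y : PBond (F.P K) 0 → Matrix (Fin N) (Fin N) ℂ, (∀ b, (Y b).trace = 0) → (F.L : ℝ) ^ k * ‖Y‖ < 1 / (25000000000 * (F.L : ℝ) * N) →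
      expOver U₀ Y ∈ 𝔥.dom)
    (hnear : ∀ Y : PBond (F.P K) 0 → Matrix (Fin N) (Fin N) ℂ, (∀ b, (Y b).trace = 0) → (F.L : ℝ) ^ k * ‖Y‖ < 1 / (25000000000 * (F.L : ℝ) * N) →
      ∀ y : Site (F.P K) k, ‖𝔥.map (expOver U₀ Y) y - 1‖ ≤ c𝔥 * ((F.L : ℝ) ^ k * ‖Y‖) ∧ ‖𝔥.inv (expOver U₀ Y) y - 1‖ ≤ c𝔥 * ((F.L : ℝ) ^ k * ‖Y‖))
    (hH : Prop4LetterHPrAtRecord F N K k Ω U₀ 𝔥 levB a hpos hQ b)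
    (hcol : letI C₂ : ℝ := 32000000000000000 * (F.L : ℝ) * N
      letI c₄ : ℝ := 1 / (200000000000 * (F.L : ℝ) * N)
      letI r : ℝ := min (c₄ / 4) (min (1 / 2) (1 / (16 * (b * C₂ + 1))))
      Prop4LetterColumnsPrAtRecord F N K k Ω U₀ 𝔥 levB a hpos hQ r Gp (min r ((1 - 4 * b * C₂ * (r + r)) * (1 / 16))) θ₃ θE θE' N₁) :
    letI C₂ : ℝ := 32000000000000000 * (F.L : ℝ) * N
    letI c₄ : ℝ := 1 / (200000000000 * (F.L : ℝ) * N)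
    letI r : ℝ := min (c₄ / 4) (min (1 / 2) (1 / (16 * (b * C₂ + 1))))
    letI R' : ℝ := min r ((1 - 4 * b * C₂ * (r + r)) * (1 / 16))
    letI CV : ℝ := 1024 * (((F.P K).d - 1 : ℕ) : ℝ) * ((1 : ℝ) * 1) ^ 3 * N * (α * (1 : ℝ) ^ 2 + 1 / 16)
        + (((F.P K).d - 1 : ℕ) : ℝ) * ((1 : ℝ) * 1) ^ 3 * (136 + 2 * ((1 : ℝ) * 1)) * N
    Prop4UniformPrAtRecord F N K k Ω U₀ 𝔥 levB a hpos hQ r Gp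
      ((N * θ₃ * (C₁ * B₃ * ε₁) + (N₁ * C₂ * (1 / (1 - 4 * b * C₂ * (r + r))) ^ 2 + N * θE')
        + N * θE * (N₁ * C₂ * (1 / (1 - 4 * b * C₂ * (r + r))) ^ 2) * R'
        + N * (1 + θE * R') * CV * (1 / (1 - 4 * b * C₂ * (r + r))) ^ 2)) R' :=
  prop4UniformPrAtRecord_node00_of_HCol F N K k Ω U₀ 𝔥 levB a hpos hQ Gp hb hΩ hα0 hα hreg hpl hc hdom hnear hH hcol
    (norm_JOfRecordAtBg_le (F := F) (N := N) (k := k) (Ω := Ω) (U₀ := U₀) hK h14)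

/-! ## §2  F8ᵖʳ — the same with the tree-side `j = 0` plaquette clause, and without it for `0 < k` -/

/-- ★★ **F7 ✓`prop4UniformAtRecord_node00_of_HCol` WITH THE `j = 0` PLAQUETTE CLAUSE ON THE TREE's CARRIER** (`hpl0 : PlaqSmall (αη_k²) U₀` instead of lit's `hpl`).
[cite: Balaban1985Variational, Prop. 4 (97)–(98) pp.292–293, (14) p.280, (44)–(45) p.285, (86)–(89) p.291] -/
theorem prop4UniformPrAtRecord_node00_of_HCol_plaqSmall [Fact (0 < (F.L : ℝ))] [Fact (0 < (F.P K).eta k)] [Fact (0 < c0Rec F K k)] [Fact (∀ c, 0 < wBRec F K k c)]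
    (𝔥 : FrameDatum (F.P K) N k U₀) (levB : PBond (F.P K) k → ℕ) (a : ℝ)
    (hpos : ∀ x, x ≠ 0 → 0 < RCLike.re ⟪x, laplaceAOfRecord F N k U₀ (QprOfRecord F N k U₀ 𝔥) (QprimeOfRecord F N k U₀) a x⟫_ℂ)
    (hQ : Function.Surjective (QprOfRecord F N k U₀ 𝔥))
    (Gp : SiteL2K ℂ (F.P K).d (fun _ => (F.P K).sitesPerDir 0) (c0Rec F K k) (WRec N) →ₗ[ℂ]
      SiteL2K ℂ (F.P K).d (fun _ => (F.P K).sitesPerDir 0) (c0Rec F K k) (WRec N))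
    {b α θ₃ θE θE' N₁ nJ : ℝ} (hb : 0 ≤ b) (hΩ : ∀ x, x ∈ Ω k) (hα0 : 0 ≤ α) (hα : α * (11000000 * N) ≤ 1)
    (hreg : ∀ j, j < k → PlaqSmall (α * ((F.L : ℝ) ^ j * (F.P K).eta k) ^ 2) (Averaging.iter (avOfRecord F N K) j U₀))
    (hpl0 : PlaqSmall (α * (F.P K).eta k ^ 2) U₀)
    {c𝔥 : ℝ} (hc : c𝔥 ≤ 1000)
    (hdom : ∀ Y : PBond (F.P K) 0 → Matrix (Fin N) (Fin N) ℂ, (∀ b, (Y b).trace = 0) → (F.L : ℝ) ^ k * ‖Y‖ < 1 / (25000000000 * (F.L : ℝ) * N) →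
      expOver U₀ Y ∈ 𝔥.dom)
    (hnear : ∀ Y : PBond (F.P K) 0 → Matrix (Fin N) (Fin N) ℂ, (∀ b, (Y b).trace = 0) → (F.L : ℝ) ^ k * ‖Y‖ < 1 / (25000000000 * (F.L : ℝ) * N) →
      ∀ y : Site (F.P K) k, ‖𝔥.map (expOver U₀ Y) y - 1‖ ≤ c𝔥 * ((F.L : ℝ) ^ k * ‖Y‖) ∧ ‖𝔥.inv (expOver U₀ Y) y - 1‖ ≤ c𝔥 * ((F.L : ℝ) ^ k * ‖Y‖))
    (hH : Prop4LetterHPrAtRecord F N K k Ω U₀ 𝔥 levB a hpos hQ b)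
    (hcol : letI C₂ : ℝ := 32000000000000000 * (F.L : ℝ) * N
      letI c₄ : ℝ := 1 / (200000000000 * (F.L : ℝ) * N)
      letI r : ℝ := min (c₄ / 4) (min (1 / 2) (1 / (16 * (b * C₂ + 1))))
      Prop4LetterColumnsPrAtRecord F N K k Ω U₀ 𝔥 levB a hpos hQ r Gp (min r ((1 - 4 * b * C₂ * (r + r)) * (1 / 16))) θ₃ θE θE' N₁)
    (hJ : ‖JOfRecordAtBg F N K k Ω U₀‖ ≤ nJ) :
    letI C₂ : ℝ := 32000000000000000 * (F.L : ℝ) * N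
    letI c₄ : ℝ := 1 / (200000000000 * (F.L : ℝ) * N)
    letI r : ℝ := min (c₄ / 4) (min (1 / 2) (1 / (16 * (b * C₂ + 1))))
    letI R' : ℝ := min r ((1 - 4 * b * C₂ * (r + r)) * (1 / 16))
    letI CV : ℝ := 1024 * (((F.P K).d - 1 : ℕ) : ℝ) * ((1 : ℝ) * 1) ^ 3 * N * (α * (1 : ℝ) ^ 2 + 1 / 16)
        + (((F.P K).d - 1 : ℕ) : ℝ) * ((1 : ℝ) * 1) ^ 3 * (136 + 2 * ((1 : ℝ) * 1)) * N
    Prop4UniformPrAtRecord F N K k Ω U₀ 𝔥 levB a hpos hQ r Gp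
      ((N * θ₃ * nJ + (N₁ * C₂ * (1 / (1 - 4 * b * C₂ * (r + r))) ^ 2 + N * θE')
        + N * θE * (N₁ * C₂ * (1 / (1 - 4 * b * C₂ * (r + r))) ^ 2) * R'
        + N * (1 + θE * R') * CV * (1 / (1 - 4 * b * C₂ * (r + r))) ^ 2)) R' :=
  prop4UniformPrAtRecord_node00_of_HCol F N K k Ω U₀ 𝔥 levB a hpos hQ Gp hb hΩ hα0 hα hreg
    (norm_plaqHolU_unitsOfRecord_sub_one_le_of_plaqSmall F N U₀ hpl0) hc hdom hnear hH hcol hJ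

/-- ★★ **F7 ✓`prop4UniformAtRecord_node00_of_HCol` FOR `0 < k` WITHOUT ANY SEPARATE `j = 0` CLAUSE**: the antecedent is (ℓa-H) + (ℓd) + print's (14) tower `hreg` + `‖J‖ ≤ nJ`.
[cite: Balaban1985Variational, Prop. 4 (97)–(98) pp.292–293, (14) p.280, (44)–(45) p.285, (86)–(89) p.291] -/
theorem prop4UniformPrAtRecord_node00_of_HCol_pos [Fact (0 < (F.L : ℝ))] [Fact (0 < (F.P K).eta k)] [Fact (0 < c0Rec F K k)] [Fact (∀ c, 0 < wBRec F K k c)]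
    (𝔥 : FrameDatum (F.P K) N k U₀) (levB : PBond (F.P K) k → ℕ) (a : ℝ)
    (hpos : ∀ x, x ≠ 0 → 0 < RCLike.re ⟪x, laplaceAOfRecord F N k U₀ (QprOfRecord F N k U₀ 𝔥) (QprimeOfRecord F N k U₀) a x⟫_ℂ)
    (hQ : Function.Surjective (QprOfRecord F N k U₀ 𝔥))
    (Gp : SiteL2K ℂ (F.P K).d (fun _ => (F.P K).sitesPerDir 0) (c0Rec F K k) (WRec N) →ₗ[ℂ]
      SiteL2K ℂ (F.P K).d (fun _ => (F.P K).sitesPerDir 0) (c0Rec F K k) (WRec N))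
    {b α θ₃ θE θE' N₁ nJ : ℝ} (hk : 0 < k) (hb : 0 ≤ b) (hΩ : ∀ x, x ∈ Ω k) (hα0 : 0 ≤ α) (hα : α * (11000000 * N) ≤ 1)
    (hreg : ∀ j, j < k → PlaqSmall (α * ((F.L : ℝ) ^ j * (F.P K).eta k) ^ 2) (Averaging.iter (avOfRecord F N K) j U₀))
    {c𝔥 : ℝ} (hc : c𝔥 ≤ 1000)
    (hdom : ∀ Y : PBond (F.P K) 0 → Matrix (Fin N) (Fin N) ℂ, (∀ b, (Y b).trace = 0) → (F.L : ℝ) ^ k * ‖Y‖ < 1 / (25000000000 * (F.L : ℝ) * N) →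
      expOver U₀ Y ∈ 𝔥.dom)
    (hnear : ∀ Y : PBond (F.P K) 0 → Matrix (Fin N) (Fin N) ℂ, (∀ b, (Y b).trace = 0) → (F.L : ℝ) ^ k * ‖Y‖ < 1 / (25000000000 * (F.L : ℝ) * N) →
      ∀ y : Site (F.P K) k, ‖𝔥.map (expOver U₀ Y) y - 1‖ ≤ c𝔥 * ((F.L : ℝ) ^ k * ‖Y‖) ∧ ‖𝔥.inv (expOver U₀ Y) y - 1‖ ≤ c𝔥 * ((F.L : ℝ) ^ k * ‖Y‖))
    (hH : Prop4LetterHPrAtRecord F N K k Ω U₀ 𝔥 levB a hpos hQ b)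
    (hcol : letI C₂ : ℝ := 32000000000000000 * (F.L : ℝ) * N
      letI c₄ : ℝ := 1 / (200000000000 * (F.L : ℝ) * N)
      letI r : ℝ := min (c₄ / 4) (min (1 / 2) (1 / (16 * (b * C₂ + 1))))
      Prop4LetterColumnsPrAtRecord F N K k Ω U₀ 𝔥 levB a hpos hQ r Gp (min r ((1 - 4 * b * C₂ * (r + r)) * (1 / 16))) θ₃ θE θE' N₁)
    (hJ : ‖JOfRecordAtBg F N K k Ω U₀‖ ≤ nJ) :
    letI C₂ : ℝ := 32000000000000000 * (F.L : ℝ) * N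
    letI c₄ : ℝ := 1 / (200000000000 * (F.L : ℝ) * N)
    letI r : ℝ := min (c₄ / 4) (min (1 / 2) (1 / (16 * (b * C₂ + 1))))
    letI R' : ℝ := min r ((1 - 4 * b * C₂ * (r + r)) * (1 / 16))
    letI CV : ℝ := 1024 * (((F.P K).d - 1 : ℕ) : ℝ) * ((1 : ℝ) * 1) ^ 3 * N * (α * (1 : ℝ) ^ 2 + 1 / 16)
        + (((F.P K).d - 1 : ℕ) : ℝ) * ((1 : ℝ) * 1) ^ 3 * (136 + 2 * ((1 : ℝ) * 1)) * N
    Prop4UniformPrAtRecord F N K k Ω U₀ 𝔥 levB a hpos hQ r Gp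
      ((N * θ₃ * nJ + (N₁ * C₂ * (1 / (1 - 4 * b * C₂ * (r + r))) ^ 2 + N * θE')
        + N * θE * (N₁ * C₂ * (1 / (1 - 4 * b * C₂ * (r + r))) ^ 2) * R'
        + N * (1 + θE * R') * CV * (1 / (1 - 4 * b * C₂ * (r + r))) ^ 2)) R' :=
  prop4UniformPrAtRecord_node00_of_HCol_plaqSmall F N K k Ω U₀ 𝔥 levB a hpos hQ Gp hb hΩ hα0 hα hreg (plaqSmall_base_of_hreg F N U₀ hk hreg) hc hdom hnear hH hcol hJ

/-- ★★ **F7 ✓`prop4UniformAtRecord_node00_of_HCol_window` WITH THE TREE-SIDE `j = 0` CLAUSE** (`‖J‖ ≤ C₁B₃ε₁` from the (14) current window by ✓`Node00.norm_JOfRecordAtBg_le`).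
[cite: Balaban1985Variational, Prop. 4 (97)–(98) pp.292–293, (14) p.280, (28) p.282] -/
theorem prop4UniformPrAtRecord_node00_of_HCol_window_plaqSmall [Fact (0 < (F.L : ℝ))] [Fact (0 < (F.P K).eta k)] [Fact (0 < c0Rec F K k)]
    [Fact (∀ c, 0 < wBRec F K k c)] (𝔥 : FrameDatum (F.P K) N k U₀) (levB : PBond (F.P K) k → ℕ) (a : ℝ)
    (hpos : ∀ x, x ≠ 0 → 0 < RCLike.re ⟪x, laplaceAOfRecord F N k U₀ (QprOfRecord F N k U₀ 𝔥) (QprimeOfRecord F N k U₀) a x⟫_ℂ)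
    (hQ : Function.Surjective (QprOfRecord F N k U₀ 𝔥))
    (Gp : SiteL2K ℂ (F.P K).d (fun _ => (F.P K).sitesPerDir 0) (c0Rec F K k) (WRec N) →ₗ[ℂ]
      SiteL2K ℂ (F.P K).d (fun _ => (F.P K).sitesPerDir 0) (c0Rec F K k) (WRec N))
    {b α θ₃ θE θE' N₁ C₁ B₃ ε₁ : ℝ} (hb : 0 ≤ b) (hΩ : ∀ x, x ∈ Ω k) (hα0 : 0 ≤ α) (hα : α * (11000000 * N) ≤ 1)
    (hreg : ∀ j, j < k → PlaqSmall (α * ((F.L : ℝ) ^ j * (F.P K).eta k) ^ 2) (Averaging.iter (avOfRecord F N K) j U₀))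
    (hpl0 : PlaqSmall (α * (F.P K).eta k ^ 2) U₀)
    (hK : 0 ≤ C₁ * B₃ * ε₁) (h14 : B11Prop6Concrete.InU2cur (F.L : ℝ) ((F.P K).eta k) (bondLevLit F Ω k) (C₁ * B₃ * ε₁) (unitsOfRecord F N U₀))
    {c𝔥 : ℝ} (hc : c𝔥 ≤ 1000)
    (hdom : ∀ Y : PBond (F.P K) 0 → Matrix (Fin N) (Fin N) ℂ, (∀ b, (Y b).trace = 0) → (F.L : ℝ) ^ k * ‖Y‖ < 1 / (25000000000 * (F.L : ℝ) * N) →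
      expOver U₀ Y ∈ 𝔥.dom)
    (hnear : ∀ Y : PBond (F.P K) 0 → Matrix (Fin N) (Fin N) ℂ, (∀ b, (Y b).trace = 0) → (F.L : ℝ) ^ k * ‖Y‖ < 1 / (25000000000 * (F.L : ℝ) * N) →
      ∀ y : Site (F.P K) k, ‖𝔥.map (expOver U₀ Y) y - 1‖ ≤ c𝔥 * ((F.L : ℝ) ^ k * ‖Y‖) ∧ ‖𝔥.inv (expOver U₀ Y) y - 1‖ ≤ c𝔥 * ((F.L : ℝ) ^ k * ‖Y‖))
    (hH : Prop4LetterHPrAtRecord F N K k Ω U₀ 𝔥 levB a hpos hQ b)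
    (hcol : letI C₂ : ℝ := 32000000000000000 * (F.L : ℝ) * N
      letI c₄ : ℝ := 1 / (200000000000 * (F.L : ℝ) * N)
      letI r : ℝ := min (c₄ / 4) (min (1 / 2) (1 / (16 * (b * C₂ + 1))))
      Prop4LetterColumnsPrAtRecord F N K k Ω U₀ 𝔥 levB a hpos hQ r Gp (min r ((1 - 4 * b * C₂ * (r + r)) * (1 / 16))) θ₃ θE θE' N₁) :
    letI C₂ : ℝ := 32000000000000000 * (F.L : ℝ) * N
    letI c₄ : ℝ := 1 / (200000000000 * (F.L : ℝ) * N)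
    letI r : ℝ := min (c₄ / 4) (min (1 / 2) (1 / (16 * (b * C₂ + 1))))
    letI R' : ℝ := min r ((1 - 4 * b * C₂ * (r + r)) * (1 / 16))
    letI CV : ℝ := 1024 * (((F.P K).d - 1 : ℕ) : ℝ) * ((1 : ℝ) * 1) ^ 3 * N * (α * (1 : ℝ) ^ 2 + 1 / 16)
        + (((F.P K).d - 1 : ℕ) : ℝ) * ((1 : ℝ) * 1) ^ 3 * (136 + 2 * ((1 : ℝ) * 1)) * N
    Prop4UniformPrAtRecord F N K k Ω U₀ 𝔥 levB a hpos hQ r Gp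
      ((N * θ₃ * (C₁ * B₃ * ε₁) + (N₁ * C₂ * (1 / (1 - 4 * b * C₂ * (r + r))) ^ 2 + N * θE')
        + N * θE * (N₁ * C₂ * (1 / (1 - 4 * b * C₂ * (r + r))) ^ 2) * R'
        + N * (1 + θE * R') * CV * (1 / (1 - 4 * b * C₂ * (r + r))) ^ 2)) R' :=
  prop4UniformPrAtRecord_node00_of_HCol_window F N K k Ω U₀ 𝔥 levB a hpos hQ Gp hb hΩ hα0 hα hreg
    (norm_plaqHolU_unitsOfRecord_sub_one_le_of_plaqSmall F N U₀ hpl0) hK h14 hc hdom hnear hH hcol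

/-- ★★ **F7 ✓`prop4UniformAtRecord_node00_of_HCol_window` FOR `0 < k` WITHOUT ANY SEPARATE `j = 0` CLAUSE**: antecedent = (ℓa-H) + (ℓd) + print's (14) (`hreg` + the current window).
[cite: Balaban1985Variational, Prop. 4 (97)–(98) pp.292–293, (14) p.280, (28) p.282] -/
theorem prop4UniformPrAtRecord_node00_of_HCol_window_pos [Fact (0 < (F.L : ℝ))] [Fact (0 < (F.P K).eta k)] [Fact (0 < c0Rec F K k)]
    [Fact (∀ c, 0 < wBRec F K k c)] (𝔥 : FrameDatum (F.P K) N k U₀) (levB : PBond (F.P K) k → ℕ) (a : ℝ)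
    (hpos : ∀ x, x ≠ 0 → 0 < RCLike.re ⟪x, laplaceAOfRecord F N k U₀ (QprOfRecord F N k U₀ 𝔥) (QprimeOfRecord F N k U₀) a x⟫_ℂ)
    (hQ : Function.Surjective (QprOfRecord F N k U₀ 𝔥))
    (Gp : SiteL2K ℂ (F.P K).d (fun _ => (F.P K).sitesPerDir 0) (c0Rec F K k) (WRec N) →ₗ[ℂ]
      SiteL2K ℂ (F.P K).d (fun _ => (F.P K).sitesPerDir 0) (c0Rec F K k) (WRec N))
    {b α θ₃ θE θE' N₁ C₁ B₃ ε₁ : ℝ} (hk : 0 < k) (hb : 0 ≤ b) (hΩ : ∀ x, x ∈ Ω k) (hα0 : 0 ≤ α) (hα : α * (11000000 * N) ≤ 1)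
    (hreg : ∀ j, j < k → PlaqSmall (α * ((F.L : ℝ) ^ j * (F.P K).eta k) ^ 2) (Averaging.iter (avOfRecord F N K) j U₀))
    (hK : 0 ≤ C₁ * B₃ * ε₁) (h14 : B11Prop6Concrete.InU2cur (F.L : ℝ) ((F.P K).eta k) (bondLevLit F Ω k) (C₁ * B₃ * ε₁) (unitsOfRecord F N U₀))
    {c𝔥 : ℝ} (hc : c𝔥 ≤ 1000)
    (hdom : ∀ Y : PBond (F.P K) 0 → Matrix (Fin N) (Fin N) ℂ, (∀ b, (Y b).trace = 0) → (F.L : ℝ) ^ k * ‖Y‖ < 1 / (25000000000 * (F.L : ℝ) * N) →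
      expOver U₀ Y ∈ 𝔥.dom)
    (hnear : ∀ Y : PBond (F.P K) 0 → Matrix (Fin N) (Fin N) ℂ, (∀ b, (Y b).trace = 0) → (F.L : ℝ) ^ k * ‖Y‖ < 1 / (25000000000 * (F.L : ℝ) * N) →
      ∀ y : Site (F.P K) k, ‖𝔥.map (expOver U₀ Y) y - 1‖ ≤ c𝔥 * ((F.L : ℝ) ^ k * ‖Y‖) ∧ ‖𝔥.inv (expOver U₀ Y) y - 1‖ ≤ c𝔥 * ((F.L : ℝ) ^ k * ‖Y‖))
    (hH : Prop4LetterHPrAtRecord F N K k Ω U₀ 𝔥 levB a hpos hQ b)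
    (hcol : letI C₂ : ℝ := 32000000000000000 * (F.L : ℝ) * N
      letI c₄ : ℝ := 1 / (200000000000 * (F.L : ℝ) * N)
      letI r : ℝ := min (c₄ / 4) (min (1 / 2) (1 / (16 * (b * C₂ + 1))))
      Prop4LetterColumnsPrAtRecord F N K k Ω U₀ 𝔥 levB a hpos hQ r Gp (min r ((1 - 4 * b * C₂ * (r + r)) * (1 / 16))) θ₃ θE θE' N₁) :
    letI C₂ : ℝ := 32000000000000000 * (F.L : ℝ) * N
    letI c₄ : ℝ := 1 / (200000000000 * (F.L : ℝ) * N)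
    letI r : ℝ := min (c₄ / 4) (min (1 / 2) (1 / (16 * (b * C₂ + 1))))
    letI R' : ℝ := min r ((1 - 4 * b * C₂ * (r + r)) * (1 / 16))
    letI CV : ℝ := 1024 * (((F.P K).d - 1 : ℕ) : ℝ) * ((1 : ℝ) * 1) ^ 3 * N * (α * (1 : ℝ) ^ 2 + 1 / 16)
        + (((F.P K).d - 1 : ℕ) : ℝ) * ((1 : ℝ) * 1) ^ 3 * (136 + 2 * ((1 : ℝ) * 1)) * N
    Prop4UniformPrAtRecord F N K k Ω U₀ 𝔥 levB a hpos hQ r Gp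
      ((N * θ₃ * (C₁ * B₃ * ε₁) + (N₁ * C₂ * (1 / (1 - 4 * b * C₂ * (r + r))) ^ 2 + N * θE')
        + N * θE * (N₁ * C₂ * (1 / (1 - 4 * b * C₂ * (r + r))) ^ 2) * R'
        + N * (1 + θE * R') * CV * (1 / (1 - 4 * b * C₂ * (r + r))) ^ 2)) R' :=
  prop4UniformPrAtRecord_node00_of_HCol_window_plaqSmall F N K k Ω U₀ 𝔥 levB a hpos hQ Gp hb hΩ hα0 hα hreg (plaqSmall_base_of_hreg F N U₀ hk hreg)
    hK h14 hc hdom hnear hH hcol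

end Record

end Summit.QuantumFields.YangMills.Theorems.C44IterMh

end
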